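import Summits.ABC.IUTFork.LDHGenuinePerImageShellRat
import Summits.ABC.IUTFork.LDHGenuinePerImageExplicit
import HarnessLib

/-!
# The fork at [IUTchIII] Corollary 3.12, L-DH level, READING (P): the UNIFORM POLE-`l` SHELL THEOREM, part 1 — a LEVEL LINE at ANY pole
# configuration, the pole `l ∈ I` allowed (abc-iut cell, crux ThetaPartII = stmt-ABC-19678; R-H round-4 census row O-18 residual R-P,
# KEY R4O18-UPOLEL; family «C:PERIMAGE-LEVEL», sibling of «C:PERIMAGE-SHELL» / «C:PERIMAGE-EVENTUAL»; part 2 = `LDHGenuinePerImageUniformPoleL`)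

Record-only PROOF file (D-0012) of the abc-iut cell (seat abc-iut-L5-t8, gen 14). TAKES NO SIDE on [IUTchIII] Cor. 3.12.
`q ∈ ℚ ∖ {0, 1}`, `j(q) = N/D` in lowest terms, `D = ∏_{p∈I} p^{e_p}` (`I` primes, `e_p ≥ 1`, `p ∤ N`), `l ≥ 7` a prime. BY NAME over
abc-iut-c312-d1's ONE-`l` SHELL TEST `Cor22.cor312PerImageOf_ratPoint_shell` (`LDHGenuinePerImageShellRat`), which ALLOWS `l` TO BE A POLE
(its `q`-side is `log q^{∤2l}(q)`, its weights run over `{p ∈ I : p ≠ 2, p ≠ l}`); its uniform form `cor312PerImageOf_ratPoint_shell_uniform`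
(p494091) and the POLYNOMIAL LEVEL `cor312PerImageOf_ratPoint_of_polyLevel` (`LDHGenuinePerImageEventualPoly`) demand `l ∉ I` / `l` above
every pole — the instantiation gap recorded in ROUND4/R4-ZETA-NEG-rcat-tst-1.md §7. Nothing of the shell estimate is re-proved here.

Notation: `Q_{≠l} := Σ_{p∈I, p∉{2,l}} e_p·log p`, `R_< := Σ_{p∈I, 2<p<l} log p`, `R_> := Σ_{p∈I, p>l} log p`, `ω_< := #{p ∈ I : 2 < p < l}`.

* `Cor22.logQAvoid_ratPoint_two_prime_eq_sum_ne` / `logCondAvoid_ratPoint_two_prime_eq_sum_ne` — the dictionary at `S = {2, l}` for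
  ANY prime `l` and any `I` (`2 ∈ I` and `l ∈ I` allowed): `log q^{∤2l}(q) = Q_{≠l}`, `log 𝔣^{∤2l}(q) = Σ_{p∈I, p∉{2,l}} log p`.
* **(T1) `Cor22.cor312PerImageOf_ratPoint_of_level`** — ANY prime `l ≥ 7` (a pole `l ∈ I` ALLOWED) and ANY pole configuration: if
  THE LEVEL LINE `Q_{≠l}/6 + (8/7)·R_< ≤ (6/7)·R_> + (ω_< + 5/6)·log l + ½·log 2 + log π` holds, then `T.Cor312PerImageOf` at EVERY
  genuine Θ-volume datum `T` of `(q, l)` — the shell test at `P_sh :=` the odd poles below `l`, `a_p := ⌊log_p l⌋`, with the polyLevel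
  bounds `1 − 1/(l·k_p) ≥ 6/7`, `1 − 1/(l−1) ≥ 5/6`, `(a_p − p^{a_p}/(l·k_p))·log p > log l − 2·log p`, the poles ABOVE `l` kept on the
  weight side (`(6/7)·R_>`) and the pole AT `l` dropped from the `q`-side (`q^{∤2l}`). With `l` above every pole (`R_> = 0`,
  `{2<p<l} = {p≠2}`, `Q_{≠l} = log D_odd`) the level line IS the hypothesis of `cor312PerImageOf_ratPoint_of_polyLevel`: (T1) strictly
  generalises it. **(T2)** `cor312PerImageAtDatum_ratPoint_of_level` (`Cor312PerImageAtDatum ∧ Cor312AtDatum`); **(T3)** the INTEGER FORM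
  `cor312PerImageAtDatum_ratPoint_of_level_pow`: `D_{≠2,l}^7 · rad_<^48 ≤ rad_>^36 · l^{42·ω_< + 35}` suffices.

SUBSUMPTION (said, not re-filed; R101): the per-row pole-`l` files `LDHGenuinePerImageSharpWildPoleLRows{A…G}` (25 rows), the last five
`LDHGenuinePerImageShellPoleLRows{A,B}` and the `…UniformShellRows…` instances stay the theorems of record for their rows; (T1) decides a
tabulated `(q, l)` by ONE `exact` whenever the row's data sit below the level line with the CRUDE constants above (desk counts on the
cell's STATUS line of this file; rows above this crude line but below their own sharp certificates are NOT subsumed). HONEST SCOPE: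
statements about OUR typed reading (P) (`Cor22.ThetaVolumeDatumAt.Cor312PerImageOf`, container (Ind2) = the tree's FULL lattice-automorphism
indeterminacy) at rational data: for every genuine Θ-volume datum `T` of such a `(q, l)`, `T.Cor312PerImageOf`. Nothing asserts that
genuine Θ-data exist at these `(q, l)`, Cor. 3.12 in general or in print's reading, or abc; proved-as-typed ≠ in print; located ≠
adjudicated. [cite: Mochizuki2012, IUTchI Def. 3.1 (a)(b)(c) p. 61–62; IUTchIII Cor. 3.12 p. 173–174, proof Step (x) p. 181; IUTchIV
Prop. 1.2 (i)(ii) p. 10, Thm. 1.10 p. 22–23, Step (ii) p. 24, Step (v) p. 27–29] [cite: DupuyHilado2025, §4.9, §4.12]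
[claim: Mochizuki2012, status: disputed] for every IUT quotation. PROOF-ONLY: no definitions, no new `Prop`, no instance, no notation.
-/

noncomputable section

open NumberField IsDedekindDomain Ideal Module

namespace Literature.IUT.LogVolume.Cor22

open Literature.NumberTheory.DiophantineGeometry.GenEll Summit.ABC.IUTFork Literature.IUT.HodgeTheaters
open Literature.NumberTheory.DiophantineGeometry.UniformABCConjecture

variable {q : ℚ} {N D : ℕ} {I : Finset ℕ} {e : ℕ → ℕ} {l : ℕ}

/-! ## 0. The dictionary at `S = {2, l}` for ANY prime `l` (pole or not) -/

/-- **`log q^{∤2l}(q) = Σ_{p∈I, p≠2, p≠l} e_p·log p`** for every prime `l`, whether or not `l` is a pole of `j(q)` and whether or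
not `2 ∈ I` (a pole AT `l` is simply absent from `q^{∤2l}`; the dictionary's `logQAvoid_ratPoint_two_prime_eq_sum` is the case `2 ∉ I`,
summing over `I ∖ {l}`). [cite: Mochizuki2012, IUTchIV Thm. 1.10 p. 23] [claim: Mochizuki2012, status: disputed] -/
theorem logQAvoid_ratPoint_two_prime_eq_sum_ne (hI : ∀ p ∈ I, p.Prime) (he : ∀ p ∈ I, e p ≠ 0)
    (hD : D = ∏ p ∈ I, p ^ e p) (hj : jInv q = (N : ℚ) / (D : ℚ)) (hN : N ≠ 0) (hcop : ∀ p ∈ I, ¬ p ∣ N)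
    (hl : l.Prime) :
    logQAvoid (ratPoint q) {2, l} = ∑ p ∈ I.filter (fun p => p ≠ 2 ∧ p ≠ l), (e p : ℝ) * Real.log p := by
  classical
  rw [logQAvoid_ratPoint_eq_sum hI he hD hj hN {2, l} (fun p hp _ => hcop p hp)]
  refine Finset.sum_congr (Finset.filter_congr fun p hp => ?_) fun _ _ => rfl
  have hpp := hI p hp
  constructor
  · intro hs
    exact ⟨fun h2 => hs 2 (by simp) ((Nat.prime_dvd_prime_iff_eq hpp Nat.prime_two).mpr h2),
      fun hl' => hs l (by simp) ((Nat.prime_dvd_prime_iff_eq hpp hl).mpr hl')⟩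
  · rintro ⟨h2, hl'⟩ s hs hps
    simp only [Finset.mem_insert, Finset.mem_singleton] at hs
    rcases hs with rfl | rfl
    · exact h2 ((Nat.prime_dvd_prime_iff_eq hpp Nat.prime_two).mp hps)
    · exact hl' ((Nat.prime_dvd_prime_iff_eq hpp hl).mp hps)

/-- **`log 𝔣^{∤2l}(q) = Σ_{p∈I, p≠2, p≠l} log p`** for every prime `l`, whether or not `l` is a pole of `j(q)` and whether or not
`2 ∈ I` (cf. the dictionary's `logCondAvoid_ratPoint_two_prime_eq_sum`, the case `2 ∉ I`). [cite: Mochizuki2012, IUTchIV Thm. 1.10 p. 23]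
[claim: Mochizuki2012, status: disputed] -/
theorem logCondAvoid_ratPoint_two_prime_eq_sum_ne (hI : ∀ p ∈ I, p.Prime) (he : ∀ p ∈ I, e p ≠ 0)
    (hD : D = ∏ p ∈ I, p ^ e p) (hj : jInv q = (N : ℚ) / (D : ℚ)) (hN : N ≠ 0) (hcop : ∀ p ∈ I, ¬ p ∣ N)
    (hl : l.Prime) :
    logCondAvoid (ratPoint q) {2, l} = ∑ p ∈ I.filter (fun p => p ≠ 2 ∧ p ≠ l), Real.log p := by
  classical
  rw [logCondAvoid_ratPoint_eq_sum hI he hD hj hN {2, l} (fun p hp _ => hcop p hp)]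
  refine Finset.sum_congr (Finset.filter_congr fun p hp => ?_) fun _ _ => rfl
  have hpp := hI p hp
  constructor
  · intro hs
    exact ⟨fun h2 => hs 2 (by simp) ((Nat.prime_dvd_prime_iff_eq hpp Nat.prime_two).mpr h2),
      fun hl' => hs l (by simp) ((Nat.prime_dvd_prime_iff_eq hpp hl).mpr hl')⟩
  · rintro ⟨h2, hl'⟩ s hs hps
    simp only [Finset.mem_insert, Finset.mem_singleton] at hs
    rcases hs with rfl | rfl
    · exact h2 ((Nat.prime_dvd_prime_iff_eq hpp Nat.prime_two).mp hps)
    · exact hl' ((Nat.prime_dvd_prime_iff_eq hpp hl).mp hps)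

/-! ## 1. (T1)–(T3): the LEVEL LINE at any pole configuration, the pole `l ∈ I` allowed -/

/-- **(T1) RATIONAL POINTS, THE LEVEL LINE AT ANY POLE CONFIGURATION (pole `l ∈ I` allowed).** `q ∈ ℚ ∖ {0,1}`, `j(q) = N/∏_{p∈I} p^{e_p}`
in lowest terms, `l ≥ 7` prime. If
`(1/6)·Σ_{p∈I, p≠2, p≠l} e_p·log p + (8/7)·Σ_{p∈I, p≠2, p<l} log p ≤ (6/7)·Σ_{p∈I, p>l} log p + (#{p∈I : p≠2, p<l} + 5/6)·log l + ½·log 2 + log π`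
then `T.Cor312PerImageOf` ([IUTchIII] Cor. 3.12 in the cell's READING (P), AS TYPED) at EVERY genuine Θ-volume datum `T` of `(q, l)`:
the one-`l` shell test with `P_sh` = the odd poles below `l`, `a_p = ⌊log_p l⌋`. With `l` above every pole this is the hypothesis of
`cor312PerImageOf_ratPoint_of_polyLevel`. [cite: Mochizuki2012, IUTchIII Cor. 3.12 p. 173–174, proof Step (x) p. 181; IUTchIV Thm. 1.10
Step (ii) p. 24, Step (v) p. 27–29] [claim: Mochizuki2012, status: disputed] -/
theorem cor312PerImageOf_ratPoint_of_level (hq0 : q ≠ 0) (hq1 : q ≠ 1)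
    (hI : ∀ p ∈ I, p.Prime) (he : ∀ p ∈ I, e p ≠ 0) (hD : D = ∏ p ∈ I, p ^ e p)
    (hj : jInv q = (N : ℚ) / (D : ℚ)) (hN : N ≠ 0) (hcop : ∀ p ∈ I, ¬ p ∣ N)
    (hl : l.Prime) (h7 : 7 ≤ l)
    (hlog : (1 / 6 : ℝ) * (∑ p ∈ I.filter (fun p => p ≠ 2 ∧ p ≠ l), (e p : ℝ) * Real.log p)
        + (8 / 7 : ℝ) * (∑ p ∈ I.filter (fun p => p ≠ 2 ∧ p < l), Real.log p) ≤
      (6 / 7 : ℝ) * (∑ p ∈ I.filter (fun p => l < p), Real.log p)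
        + (((I.filter (fun p => p ≠ 2 ∧ p < l)).card : ℝ) + 5 / 6) * Real.log l + 2⁻¹ * Real.log 2 + Real.log Real.pi)
    (T : ThetaVolumeDatumAt (ratPoint q) l) : T.Cor312PerImageOf := by
  classical
  set A : Finset ℕ := I.filter (fun p => p ≠ 2 ∧ p ≠ l) with hA
  set S : Finset ℕ := I.filter (fun p => p ≠ 2 ∧ p < l) with hS
  set U : Finset ℕ := I.filter (fun p => l < p) with hU
  set k : ℕ → ℕ := fun p => Nat.lcm (30 / Nat.gcd 30 (e p)) (if p = 3 then 2 else if p = 5 then 4 else 1) with hk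
  have hkpos : ∀ p, 0 < k p := by
    intro p
    refine Nat.pos_of_ne_zero (Nat.lcm_ne_zero ?_ (by split_ifs <;> norm_num))
    exact (Nat.div_pos (Nat.le_of_dvd (by norm_num) (Nat.gcd_dvd_left 30 (e p))) (Nat.gcd_pos_of_pos_left _ (by norm_num))).ne'
  have hl0 : l ≠ 0 := by omega
  have hlR : (7 : ℝ) ≤ l := by exact_mod_cast h7
  have hlpos : (0 : ℝ) < l := by linarith
  -- the shell poles `S` are admissible: `p ≠ 2`, `p ≠ l`, `l ∤ p − 1` (`0 < p − 1 < l`)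
  have hSI : S ⊆ I := Finset.filter_subset _ _
  have hSadm : ∀ p ∈ S, p ≠ 2 ∧ p ≠ l ∧ ¬ l ∣ p - 1 := by
    intro p hp
    obtain ⟨hpI, hp2, hpl⟩ := Finset.mem_filter.mp hp
    have hpp := hI p hpI
    refine ⟨hp2, hpl.ne, fun hdvd => ?_⟩
    have hp3 : 3 ≤ p := by
      rcases hpp.eq_two_or_odd with h2 | hodd
      · exact absurd h2 hp2
      · have := hpp.two_le; omega
    have := Nat.le_of_dvd (by omega) hdvd
    omega
  refine cor312PerImageOf_ratPoint_shell hq0 hq1 hl h7 hI he hD hj hN hcop S (fun p => Nat.log p l) hSI hSadm ?_ T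
  rw [logQAvoid_ratPoint_two_prime_eq_sum_ne hI he hD hj hN hcop hl]
  -- (0) `A = S ⊔ U`
  have hAeq : A = S ∪ U := by
    ext p
    simp only [hA, hS, hU, Finset.mem_union, Finset.mem_filter]
    constructor
    · rintro ⟨hpI, hp2, hpl⟩
      rcases lt_or_gt_of_ne hpl with h | h
      · exact Or.inl ⟨hpI, hp2, h⟩
      · exact Or.inr ⟨hpI, h⟩
    · rintro (⟨hpI, hp2, h⟩ | ⟨hpI, h⟩)
      · exact ⟨hpI, hp2, h.ne⟩
      · exact ⟨hpI, by omega, h.ne'⟩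
  have hdisj : Disjoint S U := by
    rw [hS, hU, Finset.disjoint_filter]
    intro p _ h1 h2
    omega
  have hsplit : ∑ p ∈ A, Real.log p = (∑ p ∈ S, Real.log p) + ∑ p ∈ U, Real.log p := by
    rw [hAeq, Finset.sum_union hdisj]
  -- (1) the weights: `W ≥ (6/7)·(R_< + R_>)`
  have hW : (6 / 7 : ℝ) * ((∑ p ∈ S, Real.log p) + ∑ p ∈ U, Real.log p) ≤
      ∑ p ∈ A, (1 - ((l * k p : ℕ) : ℝ)⁻¹) * Real.log p := by
    rw [← hsplit, Finset.mul_sum]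
    refine Finset.sum_le_sum fun p hp => ?_
    have hpp := hI p (Finset.mem_filter.mp hp).1
    have hlk : (7 : ℝ) ≤ ((l * k p : ℕ) : ℝ) := by
      have : 7 ≤ l * k p := le_trans h7 (Nat.le_mul_of_pos_right l (hkpos p))
      exact_mod_cast this
    have hinv : ((l * k p : ℕ) : ℝ)⁻¹ ≤ 7⁻¹ := inv_anti₀ (by norm_num) hlk
    exact mul_le_mul_of_nonneg_right (by linarith) (Real.log_nonneg (by exact_mod_cast hpp.one_lt.le))
  -- (2) `Λ(l) ≥ (5/6)·log l`
  have hΛ : (5 / 6 : ℝ) * Real.log l ≤ (1 - ((l - 1 : ℕ) : ℝ)⁻¹) * Real.log l := by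
    have h6 : (6 : ℝ) ≤ ((l - 1 : ℕ) : ℝ) := by
      have : 6 ≤ l - 1 := by omega
      exact_mod_cast this
    have hinv : ((l - 1 : ℕ) : ℝ)⁻¹ ≤ 6⁻¹ := inv_anti₀ (by norm_num) h6
    exact mul_le_mul_of_nonneg_right (by linarith) (Real.log_nonneg (by linarith))
  -- (3) the shell: each odd pole below `l` gives `> log l − 2·log p`, and the shell sum is nonnegative
  have hSh : ((S.card : ℝ)) * Real.log l - 2 * (∑ p ∈ S, Real.log p) ≤
      ∑ p ∈ S, (((Nat.log p l : ℕ) : ℝ) - (p : ℝ) ^ Nat.log p l / ((l * k p : ℕ) : ℝ)) * Real.log p := by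
    have hsum : ((S.card : ℝ)) * Real.log l - 2 * (∑ p ∈ S, Real.log p) =
        ∑ p ∈ S, (Real.log l - 2 * Real.log p) := by
      rw [Finset.sum_sub_distrib, Finset.sum_const, nsmul_eq_mul, Finset.mul_sum]
    rw [hsum]
    refine Finset.sum_le_sum fun p hp => ?_
    obtain ⟨hpI, -, hpl⟩ := Finset.mem_filter.mp hp
    have hpp := hI p hpI
    have hpR : (1 : ℝ) < p := by exact_mod_cast hpp.one_lt
    have hlogp : 0 < Real.log p := Real.log_pos hpR
    have h1 : p ^ Nat.log p l ≤ l := Nat.pow_log_le_self p hl0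
    have hlk : l ≤ l * k p := Nat.le_mul_of_pos_right l (hkpos p)
    have hratio : (p : ℝ) ^ Nat.log p l / ((l * k p : ℕ) : ℝ) ≤ 1 := by
      rw [div_le_one (by exact_mod_cast Nat.mul_pos (by omega) (hkpos p))]
      exact_mod_cast h1.trans hlk
    have h2 : l < p ^ (Nat.log p l + 1) := Nat.lt_pow_succ_log_self hpp.one_lt l
    have h2R : Real.log l < ((Nat.log p l : ℕ) + 1 : ℝ) * Real.log p := by
      have h' : (l : ℝ) < (p : ℝ) ^ (Nat.log p l + 1) := by exact_mod_cast h2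
      have := Real.log_lt_log hlpos h'
      rwa [Real.log_pow, Nat.cast_add, Nat.cast_one] at this
    nlinarith
  have hS0 : 0 ≤ ∑ p ∈ S, (((Nat.log p l : ℕ) : ℝ) - (p : ℝ) ^ Nat.log p l / ((l * k p : ℕ) : ℝ)) * Real.log p := by
    refine Finset.sum_nonneg fun p hp => ?_
    obtain ⟨hpI, -, hpl⟩ := Finset.mem_filter.mp hp
    have hpp := hI p hpI
    have ha : 0 < Nat.log p l := Nat.log_pos hpp.one_lt hpl.le
    have haR : (1 : ℝ) ≤ ((Nat.log p l : ℕ) : ℝ) := by exact_mod_cast ha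
    have h1 : p ^ Nat.log p l ≤ l := Nat.pow_log_le_self p hl0
    have hlk : l ≤ l * k p := Nat.le_mul_of_pos_right l (hkpos p)
    have hratio : (p : ℝ) ^ Nat.log p l / ((l * k p : ℕ) : ℝ) ≤ 1 := by
      rw [div_le_one (by exact_mod_cast Nat.mul_pos (by omega) (hkpos p))]
      exact_mod_cast h1.trans hlk
    exact mul_nonneg (by linarith) (Real.log_nonneg (by exact_mod_cast hpp.one_lt.le))
  -- (4) the indicator terms and constants
  have hc3 : 0 ≤ (if 3 ∈ I then 0 else 2⁻¹ * Real.log 3 : ℝ) := by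
    split_ifs
    · exact le_rfl
    · exact mul_nonneg (by norm_num) (Real.log_nonneg (by norm_num))
  have hc5 : 0 ≤ (if 5 ∈ I then 0 else (3 / 4 : ℝ) * Real.log 5 : ℝ) := by
    split_ifs
    · exact le_rfl
    · exact mul_nonneg (by norm_num) (Real.log_nonneg (by norm_num))
  have hpi : 0 < Real.log Real.pi := Real.log_pos (by linarith [Real.pi_gt_three])
  have hX0 : 0 ≤ ∑ p ∈ A, (e p : ℝ) * Real.log p :=
    Finset.sum_nonneg fun p hp => mul_nonneg (Nat.cast_nonneg _)
      (Real.log_nonneg (by exact_mod_cast (hI p (Finset.mem_filter.mp hp).1).one_lt.le))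
  -- (5) the unscaled inequality `X/6 ≤ W + ½log2 + c3 + c5 + Λ + Sh + log π`
  have hcard : (((I.filter (fun p => p ≠ 2 ∧ p < l)).card : ℝ)) = S.card := by rw [hS]
  rw [hcard] at hlog
  have hkey : (1 / 6 : ℝ) * (∑ p ∈ A, (e p : ℝ) * Real.log p) ≤
      (∑ p ∈ A, (1 - ((l * k p : ℕ) : ℝ)⁻¹) * Real.log p)
        + 2⁻¹ * Real.log 2
        + (if 3 ∈ I then 0 else 2⁻¹ * Real.log 3)
        + (if 5 ∈ I then 0 else (3 / 4 : ℝ) * Real.log 5)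
        + (1 - ((l - 1 : ℕ) : ℝ)⁻¹) * Real.log l
        + (∑ p ∈ S, (((Nat.log p l : ℕ) : ℝ) - (p : ℝ) ^ Nat.log p l / ((l * k p : ℕ) : ℝ)) * Real.log p)
        + Real.log Real.pi := by
    linarith [hW, hΛ, hSh, hc3, hc5, hlog]
  -- (6) scale by `(l+1)/4 = (l+5)/4 − 1`, `κ_l ≤ (l+1)/24`, and `(l+5)/4 ≥ (l+1)/4` on the nonnegative shell and `log π`
  have hl1 : (0 : ℝ) ≤ ((l : ℝ) + 1) / 4 := by positivity
  have h1 : (((l : ℝ) + 1) / 24 - 1 / (2 * l)) * (∑ p ∈ A, (e p : ℝ) * Real.log p) ≤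
      ((l : ℝ) + 1) / 24 * (∑ p ∈ A, (e p : ℝ) * Real.log p) := by
    have h0 : 0 ≤ 1 / (2 * (l : ℝ)) * (∑ p ∈ A, (e p : ℝ) * Real.log p) := by positivity
    rw [sub_mul]
    linarith
  have h2 := mul_le_mul_of_nonneg_left hkey hl1
  linarith [h1, h2, hS0, hpi]

/-- **(T2) `Cor312PerImageAtDatum` / `Cor312AtDatum` under the level line** (same hypotheses as (T1)): both readings of the typed
Corollary at every genuine Θ-volume datum of `(q, l)`. [cite: Mochizuki2012, IUTchIII Cor. 3.12 p. 173–174]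
[claim: Mochizuki2012, status: disputed] -/
theorem cor312PerImageAtDatum_ratPoint_of_level (hq0 : q ≠ 0) (hq1 : q ≠ 1)
    (hI : ∀ p ∈ I, p.Prime) (he : ∀ p ∈ I, e p ≠ 0) (hD : D = ∏ p ∈ I, p ^ e p)
    (hj : jInv q = (N : ℚ) / (D : ℚ)) (hN : N ≠ 0) (hcop : ∀ p ∈ I, ¬ p ∣ N)
    (hl : l.Prime) (h7 : 7 ≤ l)
    (hlog : (1 / 6 : ℝ) * (∑ p ∈ I.filter (fun p => p ≠ 2 ∧ p ≠ l), (e p : ℝ) * Real.log p)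
        + (8 / 7 : ℝ) * (∑ p ∈ I.filter (fun p => p ≠ 2 ∧ p < l), Real.log p) ≤
      (6 / 7 : ℝ) * (∑ p ∈ I.filter (fun p => l < p), Real.log p)
        + (((I.filter (fun p => p ≠ 2 ∧ p < l)).card : ℝ) + 5 / 6) * Real.log l + 2⁻¹ * Real.log 2 + Real.log Real.pi) :
    Cor312PerImageAtDatum (ratPoint q) l ∧ Cor312AtDatum (ratPoint q) l :=
  have h : Cor312PerImageAtDatum (ratPoint q) l :=
    fun T => cor312PerImageOf_ratPoint_of_level hq0 hq1 hI he hD hj hN hcop hl h7 hlog T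
  ⟨h, cor312AtDatum_of_perImage h⟩

/-- **(T3) THE INTEGER FORM OF THE LEVEL LINE**: `D_{≠2,l} := ∏_{p∈I, p≠2, p≠l} p^{e_p}`, `rad_< := ∏_{p∈I, p≠2, p<l} p`,
`rad_> := ∏_{p∈I, p>l} p`, `ω_< := #{p∈I : p≠2, p<l}`. Every prime `l ≥ 7` (pole or not) with
**`D_{≠2,l}^7 · rad_<^48 ≤ rad_>^36 · l^{42·ω_< + 35}`** gives the typed Corollary in both readings at every genuine Θ-volume datum of
`(q, l)` (take logs, divide by `42`, `½·log 2 + log π > 0`). [cite: Mochizuki2012, IUTchIII Cor. 3.12 p. 173–174; IUTchIV Thm. 1.10 p. 23]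
[claim: Mochizuki2012, status: disputed] -/
theorem cor312PerImageAtDatum_ratPoint_of_level_pow (hq0 : q ≠ 0) (hq1 : q ≠ 1)
    (hI : ∀ p ∈ I, p.Prime) (he : ∀ p ∈ I, e p ≠ 0) (hD : D = ∏ p ∈ I, p ^ e p)
    (hj : jInv q = (N : ℚ) / (D : ℚ)) (hN : N ≠ 0) (hcop : ∀ p ∈ I, ¬ p ∣ N)
    (hl : l.Prime) (h7 : 7 ≤ l)
    (hpow : (∏ p ∈ I.filter (fun p => p ≠ 2 ∧ p ≠ l), p ^ e p) ^ 7 * (∏ p ∈ I.filter (fun p => p ≠ 2 ∧ p < l), p) ^ 48 ≤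
      (∏ p ∈ I.filter (fun p => l < p), p) ^ 36 * l ^ (42 * (I.filter (fun p => p ≠ 2 ∧ p < l)).card + 35)) :
    Cor312PerImageAtDatum (ratPoint q) l ∧ Cor312AtDatum (ratPoint q) l := by
  classical
  refine cor312PerImageAtDatum_ratPoint_of_level hq0 hq1 hI he hD hj hN hcop hl h7 ?_
  set A : Finset ℕ := I.filter (fun p => p ≠ 2 ∧ p ≠ l) with hA
  set S : Finset ℕ := I.filter (fun p => p ≠ 2 ∧ p < l) with hS
  set U : Finset ℕ := I.filter (fun p => l < p) with hU
  have hApos : ∀ p ∈ A, 0 < p := fun p hp => (hI p (Finset.mem_filter.mp hp).1).pos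
  have hSpos : ∀ p ∈ S, 0 < p := fun p hp => (hI p (Finset.mem_filter.mp hp).1).pos
  have hUpos : ∀ p ∈ U, 0 < p := fun p hp => (hI p (Finset.mem_filter.mp hp).1).pos
  have hlR : (7 : ℝ) ≤ l := by exact_mod_cast h7
  -- logs of the three products
  have hQ : Real.log (((∏ p ∈ A, p ^ e p : ℕ)) : ℝ) = ∑ p ∈ A, (e p : ℝ) * Real.log p := by
    rw [Nat.cast_prod, Real.log_prod]
    · exact Finset.sum_congr rfl fun p _ => by rw [Nat.cast_pow, Real.log_pow]
    · intro p hp; exact_mod_cast (pow_pos (hApos p hp) _).ne'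
  have hR1 : Real.log (((∏ p ∈ S, p : ℕ)) : ℝ) = ∑ p ∈ S, Real.log p := by
    rw [Nat.cast_prod, Real.log_prod]
    intro p hp; exact_mod_cast (hSpos p hp).ne'
  have hR2 : Real.log (((∏ p ∈ U, p : ℕ)) : ℝ) = ∑ p ∈ U, Real.log p := by
    rw [Nat.cast_prod, Real.log_prod]
    intro p hp; exact_mod_cast (hUpos p hp).ne'
  have hP1 : (0 : ℝ) < (((∏ p ∈ A, p ^ e p : ℕ)) : ℝ) := by
    exact_mod_cast Finset.prod_pos fun p hp => pow_pos (hApos p hp) _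
  have hP2 : (0 : ℝ) < (((∏ p ∈ S, p : ℕ)) : ℝ) := by exact_mod_cast Finset.prod_pos hSpos
  have hP3 : (0 : ℝ) < (((∏ p ∈ U, p : ℕ)) : ℝ) := by exact_mod_cast Finset.prod_pos hUpos
  -- take logs in `hpow`
  have h1 : (((∏ p ∈ A, p ^ e p : ℕ) : ℝ)) ^ 7 * (((∏ p ∈ S, p : ℕ) : ℝ)) ^ 48 ≤
      (((∏ p ∈ U, p : ℕ) : ℝ)) ^ 36 * (l : ℝ) ^ (42 * S.card + 35) := by
    exact_mod_cast hpow
  have h2 := Real.log_le_log (by positivity) h1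
  rw [Real.log_mul (by positivity) (by positivity), Real.log_mul (by positivity) (by positivity),
    Real.log_pow, Real.log_pow, Real.log_pow, Real.log_pow, hQ, hR1, hR2] at h2
  push_cast at h2
  have hlog2 : 0 < Real.log 2 := Real.log_pos (by norm_num)
  have hpi : 0 < Real.log Real.pi := Real.log_pos (by linarith [Real.pi_gt_three])
  have hcard : (((I.filter (fun p => p ≠ 2 ∧ p < l)).card : ℝ)) = S.card := by rw [hS]
  rw [hcard]
  nlinarith [h2, hlog2, hpi]

end Literature.IUT.LogVolume.Cor22

end
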